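import Summits.CriticalPhenomena.PercolationContinuityZ3.Theorems.FK.Transplant.UFSC0FreeSlabGluing
import Summits.CriticalPhenomena.PercolationContinuityZ3.Theorems.FK.Transplant.KNFreeSlabUFSC0
import HarnessLib

/-!
# FRONTIER TRANSPLANT — K1 IN FINITE FORM (K1-FIN): `UFSC0` at `p` gives Grimmett's FINITE free-slab percolation `Π(p, 5r)`
# at the SAME `p`; hence `(∃ r, UFSC0) ⟺ (∃ L, Π(p, L))` for every `q ≥ 1`, `d ≥ 3` — the referee's calibration K1 as a
# kernel EQUIVALENCE

Support file (`--supports stmt-CriticalPhenomena-4575`, helper) of the FRONTIER TRANSPLANT sub-cell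
(`fk-continuity/transplant/`, seat `prim-bschramm-fkt-p3`); builds on p205010 (kernel theorem, internal audit signed;
external expert review pending). Memo row K1-FIN [g130, R67] (bytes-first package; headline host). 0 named facts ·
0 sorries · standard axioms; `FH` does not occur in this file.
Registered R70 (cell INBOX l.5267, 2026-08-23); registry row T4k; lead label T4k-09 (fkt-lead L44, l.5255).
Gate-prescribed dedup (dry-run probe `dedup.landed`, 2026-08-23T22:31Z; R70 (γ) stated delta): the private copy
`edgesIn_mono` (≡ landed `Theorems.Rsw3.edgesIn_mono_zd`) is deleted; the use cites the landed general
`Literature.Probability.LatticeModels.edgesIn_mono` (`GKSInequalities`).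

HONEST FRAMING (page 1, cell rule). The transplant's theorem of record `ufsc0_of_freeBoundaryHypothesis_r3` (p248245) is
CONDITIONAL on FH AND on TP_FK = `KNFreeTargetHittable d q p`, both OPEN at the same `p` for `q > 1` near `p_c(q)` (⇔ GRC
Conj. (5.103) via K1; barrier note `Literature.Barriers.CriticalPhenomena.SamePFreeBoundaryCriteria`, FBN-01, cited
first); the transplant is a typed reduction, not a proof of FK continuity. THIS FILE identifies the record's CONCLUSION
with a printed object: `∃ r, UFSC0 d q p r ε₀` (`0 < ε₀`, `4ε₀ ≤ 2⁻³²`, `0 < p < 1`) holds IFF Grimmett's slab condition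
`Π(p, L)` (`FKSlabPercolation`, (5.102)) holds for some `L` — so the record reads "FH ∧ TP_FK at p ⟹ Π(p, L) for some L",
and `inf {p : ∃ r, UFSC0} = p̂_c(q)` exactly. NOT a discharge of FH or TP_FK, NOT `_r4`, no FH / TP_FK concluder;
`_r3` « 2 / 0 ☑ », n_open = 2, BINDER-OWNERS, FO-19 NO-GO unchanged. Nothing at `p ↓ p_c(q)`.

## What is here (namespace `Summit.CriticalPhenomena.PercolationContinuityZ3.Theorems.FK`)

* §1 `exists_near_macro` (every planar coordinate of the slab box is within `50r` of a good macro-column), `slabBox_mono`,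
  `pow_card_le_fkLaw_real_openConnIn` (small boxes: open everything);
* §2 **`SameP.exists_pos_forall_fkLaw_slabBox_openConnIn`** — `UFSC0`'s clauses for `S` (`q ≥ 1`, `4ε₀ ≤ 2⁻³²`, `δ ≤ 1`,
  `0 < p`) give `α > 0` with `α < φ⁰_{Λ_N}(0 ↔ x in Λ_N)` for EVERY `N` and EVERY `x ∈ Λ_N` (slab box of the scheme:
  thickness `5r` across KN's plane): large `N` by files (P3a)/(P3b), small `N` by insertion tolerance alone;
* §3 `exists_perm_axes`, `image_slabBox_eq_fkSlab` (a coordinate permutation carries the scheme's slab box onto the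
  barrier note's `fkSlab d (5r) N`), and the headlines **`fkSlabPercolation_of_ufsc0`**
  (`UFSC0 d q p r ε₀ → FKSlabPercolation d p q (5r)`), **`exists_ufsc0_iff_exists_fkSlabPercolation`** (with T4s-18
  `ufsc0_of_exists_fkSlabPercolation`, `d ≥ 3`), `fkSlabCriticalProb_le_of_ufsc0` (`UFSC0` at `p` ⟹ `p̂_c(q) ≤ p`).

## References

* G. Grimmett, *The Random-Cluster Model*, Springer 2006, §5.7 eq. (5.102), Conj. (5.103); Thm. (3.1) eq. (3.4) [Grimmett2006].
* G. Kozma, S. Nitzan, arXiv:2401.12397 (2024), §4 Theorem 6 (pp. 25–31) [KozmaNitzan2024].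
* F. Severo, arXiv (2024), §1 (p̂_c(q)) [Severo2024]; T. Bodineau, PTRF 2005, Thm. 2.1 [Bodineau2005].
-/

noncomputable section

namespace Summit.CriticalPhenomena.PercolationContinuityZ3.Theorems.FK

open MeasureTheory Literature.Probability.Percolation Literature.Probability.LatticeModels
open Literature.Probability.Percolation.ProbeHistory Literature.Probability.Percolation.HSiteScheme
open Literature.Probability.Percolation.KozmaNitzan Literature.Probability.Percolation.GadgetSystem
open Literature.Barriers.CriticalPhenomena
open KSch Cells
open scoped ENNReal Classical

variable {d : ℕ} {S : KSch d} {q : ℝ}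

/-! ### §1 Nearest good macro-column; small boxes -/

/-- **Every coordinate value of the slab box is within `50r` of a good macro-column**: if `|v| ≤ N ≤ 20rn + 50r` then
`|v - 20rt| ≤ 50r` for some `|t| ≤ n` (divide by `20r` and clamp). [folklore] -/
theorem exists_near_macro {r : ℤ} (hr : 0 < r) {n : ℕ} {N v : ℤ} (hN : N ≤ 20 * r * n + 50 * r) (hv : |v| ≤ N) :
    ∃ t : ℤ, |t| ≤ n ∧ |v - 20 * r * t| ≤ 50 * r := by
  set m : ℤ := 20 * r with hm
  have hm0 : 0 < m := by positivity
  set t₀ := v / m with ht₀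
  have hdiv : m * t₀ + v % m = v := Int.mul_ediv_add_emod v m
  have he0 : 0 ≤ v % m := Int.emod_nonneg v hm0.ne'
  have he1 : v % m < m := Int.emod_lt_of_pos v hm0
  obtain ⟨hv1, hv2⟩ := abs_le.1 hv
  by_cases h1 : (n : ℤ) < t₀
  · refine ⟨n, by rw [abs_of_nonneg (by positivity)], ?_⟩
    have h : m * (n + 1) ≤ m * t₀ := mul_le_mul_of_nonneg_left (by omega) hm0.le
    rw [mul_add, mul_one] at h
    rw [abs_le]; constructor <;> linarith
  · by_cases h2 : t₀ < -(n : ℤ)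
    · refine ⟨-n, by rw [abs_neg, abs_of_nonneg (by positivity)], ?_⟩
      have h : m * t₀ ≤ m * (-(n : ℤ) - 1) := mul_le_mul_of_nonneg_left (by omega) hm0.le
      rw [mul_sub, mul_one, mul_neg] at h
      rw [mul_neg, abs_le]; constructor <;> linarith
    · refine ⟨t₀, abs_le.2 ⟨by omega, by omega⟩, ?_⟩
      rw [abs_le]; constructor <;> linarith

/-- The slab boxes increase with `N`. [folklore] -/
theorem slabBox_mono {N N' : ℕ} (h : N ≤ N') : slabBox S N ⊆ slabBox S N' := by
  intro x hx
  rw [mem_slabBox_iff] at hx ⊢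
  intro j
  refine (hx j).trans ?_
  unfold slabW
  split_ifs
  · exact_mod_cast h
  · exact le_rfl

-- `edgesIn` is monotone in the region: the landed general lemma `Literature.Probability.LatticeModels.edgesIn_mono`
-- (module `GKSInequalities`, already in the import closure) is reused at `G = zdGraph d` (gate-prescribed dedup; the
-- exact twin named by the gate is `Theorems.Rsw3.edgesIn_mono_zd`, itself that specialisation).

/-- **Small boxes: open everything.** Under the free law of the slab box `Λ_N` (`q ≥ 1`), for every `x ∈ Λ_N`,
`π^{|E(Λ_N)|} ≤ φ⁰_{Λ_N}(0 ↔ x in Λ_N)` (`π = p/(p+q(1-p))`): opening all lattice edges of the box joins `0` to `x`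
inside it (a lattice path in the order interval, `exists_walk_Icc`), and insertion tolerance prices this.
[cite: Grimmett2006, Thm. (3.1) eq. (3.4)] -/
theorem pow_card_le_fkLaw_real_openConnIn (hq : 1 ≤ q) {N : ℕ} {x : Site d} (hx : x ∈ slabBox S N) :
    ((S.p : ℝ) / (S.p + q * (1 - S.p))) ^ (edgesIn (zdGraph d) (slabBox S N)).card ≤
      (fkLaw (slabBox S N) (restrW (↑(slabBox S N) : Set (Site d)) (lattW d S.p)) q).real
        (openConnIn (↑(slabBox S N) : Set (Site d)) 0 x) := by
  set Λ := slabBox S N with hΛ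
  set μ := fkLaw Λ (restrW (↑Λ : Set (Site d)) (lattW d S.p)) q with hμ
  haveI : IsProbabilityMeasure μ := (isPinningLaw_fkLaw Λ hq).prob _
  set F := edgesIn (zdGraph d) Λ with hF
  have h := KNFree.ins_tolerance_fkLaw hq Λ (restrW (↑Λ : Set (Site d)) (lattW d S.p)) (F := F)
    (fun e he => restrW_lattW_of_mem_edgesIn subset_rfl S.p he) (fun e he z hz => (mem_edgesIn_iff.1 he).2 z hz)
    (DCT16.measurableSet_openConnIn Λ 0 x)
  have huniv : (fun ω : BondConfig (Site d) => ω ∪ ↑F) ⁻¹' openConnIn (↑Λ : Set (Site d)) 0 x = Set.univ := by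
    ext ω
    simp only [Set.mem_preimage, Set.mem_univ, iff_true]
    have h0 : (0 : Site d) ∈ Set.Icc (-slabW S N) (slabW S N) := by
      have := zero_mem_slabBox S N; rwa [slabBox, Finset.mem_Icc] at this
    have hxI : x ∈ Set.Icc (-slabW S N) (slabW S N) := by rwa [hΛ, slabBox, Finset.mem_Icc] at hx
    obtain ⟨W, -, hW⟩ := exists_walk_Icc (-slabW S N) (slabW S N) _ 0 x rfl h0 hxI
    have hWΛ : ∀ z ∈ W.support, z ∈ (↑Λ : Set (Site d)) := fun z hz => by
      rw [hΛ, Finset.mem_coe, slabBox, Finset.mem_Icc]; exact hW z hz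
    refine mem_openConnIn_of_walk W hWΛ fun e he => Set.mem_union_right _ (Finset.mem_coe.2 ?_)
    rw [hF, mem_edgesIn_iff]
    refine ⟨W.edges_subset_edgeSet he, fun z hz => ?_⟩
    induction e using Sym2.ind with
    | h u v =>
      rcases Sym2.mem_iff.1 hz with rfl | rfl
      · exact Finset.mem_coe.1 (hWΛ z (W.fst_mem_support_of_mem_edges he))
      · exact Finset.mem_coe.1 (hWΛ z (W.snd_mem_support_of_mem_edges he))
  rw [huniv, ← hμ, probReal_univ, mul_one] at h
  exact h

/-! ### §2 Slab percolation in the scheme's orientation -/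

namespace SameP

/-- **`UFSC0`'s clauses give FINITE free-slab percolation in the scheme's orientation**: for `q ≥ 1`, `4ε₀ ≤ 2⁻³²`,
`δ ≤ 1`, `0 < p` and a Kozma–Nitzan scheme `S` satisfying (32)-FK at the origin and the per-direction bound `≤ ε₀` after
FK-valid histories, there is `α > 0` with `α < φ⁰_{Λ_N}(0 ↔ x in Λ_N)` for EVERY `N` and EVERY `x ∈ Λ_N`
(`Λ_N = slabBox S N`, thickness `5r`). For `N ≥ 30r + 1`: `n = ⌊(N - 30r - 1)/20r⌋`, `x` is within planar distance `50r`
of a macro-column `y ∈ Λ_n` (`exists_near_macro`), and `le_fkLaw_slabBox_real_openConnIn` applies with the glue cost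
bounded uniformly (`card_glueEdges_le`); for `N ≤ 30r`: `pow_card_le_fkLaw_real_openConnIn`.
[cite: KozmaNitzan2024, §4 Theorem 6 (pp. 25–31); Grimmett2006, §5.7 eq. (5.102), Conj. (5.103), Thm. (3.1) eq. (3.4)] -/
theorem exists_pos_forall_fkLaw_slabBox_openConnIn (hq : 1 ≤ q) {ε₀ : ℝ} (hε : 4 * ε₀ ≤ (1 / 2 : ℝ) ^ 32)
    (hδ1 : S.δc ≤ 1) (hQ0 : ∀ du : MDir, OriginFK S q du)
    (hbad : ∀ (h : ProbeHistory (Site d)) (e : Site 2 × MDir) (du : MDir), ValidFK S q h e →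
      du ∈ S.onward h (tgt e) → (fkLaw (S.Sx h e du) (S.Wfull h e du) q).real (badFK S q h e du) ≤ ε₀)
    (hp0 : 0 < (S.p : ℝ)) :
    ∃ α : ℝ, 0 < α ∧ ∀ (N : ℕ) (x : Site d), x ∈ slabBox S N →
      α < (fkLaw (slabBox S N) (restrW (↑(slabBox S N) : Set (Site d)) (lattW d S.p)) q).real
        (openConnIn (↑(slabBox S N) : Set (Site d)) 0 x) := by
  set r := S.C.r with hr
  have hr1 : 1 ≤ r := S.C.r_pos
  set π : ℝ := (S.p : ℝ) / (S.p + q * (1 - S.p)) with hπ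
  have hden := insertionDenominator_pos S.p.2 hq
  have hπ0 : 0 < π := div_pos hp0 hden
  have hπ1 : π ≤ 1 := by
    rw [hπ, div_le_one hden]
    have : 0 ≤ q * (1 - (S.p : ℝ)) := mul_nonneg (by linarith) (sub_nonneg.2 S.p.2.2)
    linarith
  set B₀ := (edgesIn (zdGraph d) (slabBox S (30 * r))).card with hB₀
  set B₁ := 2 * d * (132 * r + 1) ^ d + S.U₀.card with hB₁
  refine ⟨1 / 2 * (5 / 6 * π ^ (B₀ + B₁)), by positivity, fun N x hx => ?_⟩
  have hgoal : 5 / 6 * π ^ (B₀ + B₁) ≤ (fkLaw (slabBox S N) (restrW (↑(slabBox S N) : Set (Site d)) (lattW d S.p)) q).real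
      (openConnIn (↑(slabBox S N) : Set (Site d)) 0 x) := by
    by_cases hN : N ≤ 30 * r
    · -- small box: open everything
      have h := pow_card_le_fkLaw_real_openConnIn (S := S) hq hx
      have hcard : (edgesIn (zdGraph d) (slabBox S N)).card ≤ B₀ + B₁ :=
        (Finset.card_le_card (edgesIn_mono (zdGraph d) (slabBox_mono hN))).trans (Nat.le_add_right _ _)
      calc 5 / 6 * π ^ (B₀ + B₁) ≤ 1 * π ^ (B₀ + B₁) :=
            mul_le_mul_of_nonneg_right (by norm_num) (pow_nonneg hπ0.le _)
        _ ≤ π ^ (edgesIn (zdGraph d) (slabBox S N)).card := by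
            rw [one_mul]; exact pow_le_pow_of_le_one hπ0.le hπ1 hcard
        _ ≤ _ := h
    · -- large box: reach a good macro-column near `x`, then glue
      push Not at hN
      set n := (N - 30 * r - 1) / (20 * r) with hn
      have h20 : 0 < 20 * r := by omega
      have hdiv : n * (20 * r) ≤ N - 30 * r - 1 := hn ▸ Nat.div_mul_le_self (N - 30 * r - 1) (20 * r)
      have hlt : N - 30 * r - 1 < n * (20 * r) + 20 * r := hn ▸ Nat.lt_div_mul_add h20
      have hNn : 20 * r * (n + 1) + 10 * r + 1 ≤ N := by
        have e : 20 * r * (n + 1) = n * (20 * r) + 20 * r := by ring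
        rw [e]; omega
      have hNle : (N : ℤ) ≤ 20 * (r : ℤ) * n + 50 * r := by
        have h' : N ≤ n * (20 * r) + 50 * r := by omega
        have h'' : (N : ℤ) ≤ (n : ℤ) * (20 * r) + 50 * r := by exact_mod_cast h'
        linarith
      -- the good macro-column near `x`
      have hxpl : ∀ i : Fin 2, |x (S.C.pax i)| ≤ (N : ℤ) := fun i => by
        have := (mem_slabBox_iff.1 hx) (S.C.pax i); rwa [slabW_pax] at this
      have hr0 : (0 : ℤ) < r := by exact_mod_cast hr1
      obtain ⟨t0, ht0, hd0⟩ := exists_near_macro hr0 hNle (hxpl 0)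
      obtain ⟨t1, ht1, hd1⟩ := exists_near_macro hr0 hNle (hxpl 1)
      set y : Site 2 := fun i => if i = 0 then t0 else t1 with hy
      have hyb : y ∈ box 2 n := by
        rw [mem_box]
        intro i
        fin_cases i
        · simpa [hy] using abs_le.1 ht0
        · simpa [hy] using abs_le.1 ht1
      have hxy : ∀ i : Fin 2, |x (S.C.pax i) - 20 * S.C.r * y i| ≤ 50 * S.C.r := by
        intro i
        fin_cases i
        · simpa [hy] using hd0
        · simpa [hy] using hd1
      have h := le_fkLaw_slabBox_real_openConnIn hq hε hδ1 hQ0 hbad hNn hyb hx hxy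
      have hcard : (glueEdges S N y).card + S.U₀.card ≤ B₀ + B₁ := by
        have := card_glueEdges_le (S := S) N y
        rw [← hr] at this
        omega
      calc 5 / 6 * π ^ (B₀ + B₁) ≤ 5 / 6 * π ^ ((glueEdges S N y).card + S.U₀.card) :=
            mul_le_mul_of_nonneg_left (pow_le_pow_of_le_one hπ0.le hπ1 hcard) (by norm_num)
        _ ≤ _ := h
  have hpos : 0 < 5 / 6 * π ^ (B₀ + B₁) := by positivity
  linarith

end SameP

/-! ### §3 From the scheme's orientation to the barrier note's `fkSlab`; the headlines -/

/-- **A coordinate permutation carrying KN's planar axes to the last two coordinates** (`d ≥ 3`).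
[folklore] -/
theorem exists_perm_axes (S : KSch d) :
    ∃ π : Equiv.Perm (Fin d), π S.C.ax0 = ⟨d - 2, by have := S.C.hd; omega⟩ ∧
      π S.C.ax1 = ⟨d - 1, by have := S.C.hd; omega⟩ := by
  have hd := S.C.hd
  set t0 : Fin d := ⟨d - 2, by omega⟩ with ht0
  set t1 : Fin d := ⟨d - 1, by omega⟩ with ht1
  have ha0 : (S.C.ax0 : Fin d).val = 1 := rfl
  have ha1 : (S.C.ax1 : Fin d).val = 2 := rfl
  have hne01 : S.C.ax0 ≠ S.C.ax1 := S.C.ax0_ne_ax1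
  have hne0t1 : S.C.ax0 ≠ t1 := by
    intro h; have := congrArg Fin.val h; rw [ha0] at this; simp [ht1] at this; omega
  have hnet10 : t1 ≠ S.C.ax0 := fun h => hne0t1 h.symm
  have hnet1t0 : t1 ≠ t0 := by
    intro h; have := congrArg Fin.val h; simp [ht0, ht1] at this; omega
  refine ⟨Equiv.swap S.C.ax0 t0 * Equiv.swap S.C.ax1 t1, ?_, ?_⟩
  · have h1 : Equiv.swap S.C.ax1 t1 S.C.ax0 = S.C.ax0 := Equiv.swap_apply_of_ne_of_ne hne01 hne0t1
    rw [Equiv.Perm.mul_apply, h1, Equiv.swap_apply_left]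
  · have h1 : Equiv.swap S.C.ax1 t1 S.C.ax1 = t1 := Equiv.swap_apply_left _ _
    rw [Equiv.Perm.mul_apply, h1, Equiv.swap_apply_of_ne_of_ne hnet10 hnet1t0]

/-- **The permutation carries the scheme's slab box onto `fkSlab d (5r) N`** (the barrier note's slab box: thin
coordinates first, the two long coordinates last). [cite: Grimmett2006, §5.7 (S(L, n))] -/
theorem image_slabBox_eq_fkSlab (π : Equiv.Perm (Fin d))
    (hπ0 : π S.C.ax0 = ⟨d - 2, by have := S.C.hd; omega⟩) (hπ1 : π S.C.ax1 = ⟨d - 1, by have := S.C.hd; omega⟩) (N : ℕ) :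
    (slabBox S N).image (zdSignedPermIso π (1 : Fin d → ℤˣ)) = fkSlab d (5 * S.C.r) N := by
  have hd := S.C.hd
  -- the half-widths match along `π`
  have hw : ∀ j, slabW S N j = (fkSlabHalfWidth d (5 * S.C.r) N (π j) : ℤ) := by
    intro j
    unfold fkSlabHalfWidth
    by_cases h0 : j = S.C.ax0
    · subst h0; rw [hπ0, if_pos (by simp; omega)]; unfold slabW; rw [if_pos (Or.inl rfl)]
    · by_cases h1 : j = S.C.ax1
      · subst h1; rw [hπ1, if_pos (by simp; omega)]; unfold slabW; rw [if_pos (Or.inr rfl)]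
      · rw [slabW_of_ne S N h0 h1, if_neg]
        · push_cast; ring
        · intro hle
          have hv : (π j).val < d := (π j).isLt
          have hne0 : π j ≠ π S.C.ax0 := fun h => h0 (π.injective h)
          have hne1 : π j ≠ π S.C.ax1 := fun h => h1 (π.injective h)
          rw [hπ0] at hne0; rw [hπ1] at hne1
          have hv0 : (π j).val ≠ d - 2 := fun h => hne0 (Fin.ext h)
          have hv1 : (π j).val ≠ d - 1 := fun h => hne1 (Fin.ext h)
          omega
  ext y
  rw [Finset.mem_image, mem_fkSlab]
  constructor
  · rintro ⟨x, hx, rfl⟩ i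
    have hxj := (mem_slabBox_iff.1 hx) (π.symm i)
    rw [hw, Equiv.apply_symm_apply] at hxj
    simp only [zdSignedPermIso_apply, Site.signedPerm_apply, Pi.one_apply, Units.val_one, one_mul]
    exact abs_le.1 hxj
  · intro hy
    refine ⟨(Site.signedPerm π 1).symm y, ?_, ?_⟩
    · rw [mem_slabBox_iff]
      intro j
      simp only [Site.signedPerm_symm_apply, Pi.one_apply, Units.val_one, one_mul]
      rw [hw]
      exact abs_le.2 (hy (π j))
    · rw [zdSignedPermIso_apply, Equiv.apply_symm_apply]

/-- **K1-FIN — `UFSC0` AT `p` GIVES GRIMMETT'S FINITE FREE-SLAB PERCOLATION `Π(p, 5r)` AT THE SAME `p`** (every `q ≥ 1`;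
`d ≥ 3` is part of the scheme; `0 < p`; `4ε₀ ≤ 2⁻³²`): a `UFSC0 d q p r ε₀` witness `S` gives
`FKSlabPercolation d p q (5r)` — `∃ α > 0`, for ALL `N` and ALL `x ∈ S(5r, N)`, `φ⁰_{S(5r,N),p,q}(0 ↔ x) > α`
(`SameP.exists_pos_forall_fkLaw_slabBox_openConnIn`, transported to the barrier note's slab box by a coordinate
permutation, `fkLaw_image_iso_restrW_lattW_real_openConnIn`, and read through `fkLaw_fkSlab_real_openConnIn`). With
T4s-18 (`ufsc0_of_fkSlabPercolation`) this makes the referee's calibration K1 a kernel EQUIVALENCE. NOT a discharge of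
FH or TP_FK; the record `_r3` is unchanged. [cite: KozmaNitzan2024, §4 Theorem 6 (pp. 25–31); Grimmett2006, §5.7 eq. (5.102), Conj. (5.103)] -/
theorem fkSlabPercolation_of_ufsc0 {q ε₀ : ℝ} (hq : 1 ≤ q) (hε : 4 * ε₀ ≤ (1 / 2 : ℝ) ^ 32) {p : unitInterval}
    (hp : 0 < (p : ℝ)) {r : ℕ} (hU : UFSC0 d q p r ε₀) : FKSlabPercolation d (p : ℝ) q (5 * r) := by
  obtain ⟨S, hSp, hSr, -, hδ1, hQ0, hbad⟩ := hU
  subst hSp hSr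
  have hq0 : 0 < q := one_pos.trans_le hq
  obtain ⟨α, hα, hmain⟩ := SameP.exists_pos_forall_fkLaw_slabBox_openConnIn hq hε hδ1 hQ0 hbad hp
  obtain ⟨π, hπ0, hπ1⟩ := exists_perm_axes S
  refine ⟨α, hα, fun N x' => ?_⟩
  set g := zdSignedPermIso π (1 : Fin d → ℤˣ) with hg
  have himg := image_slabBox_eq_fkSlab (S := S) π hπ0 hπ1 N
  -- the preimage point of the scheme's slab box
  set x : Site d := (Site.signedPerm π 1).symm (x' : Site d) with hxdef
  have hgx : g x = (x' : Site d) := by rw [hg, zdSignedPermIso_apply, hxdef, Equiv.apply_symm_apply]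
  have hx : x ∈ slabBox S N := by
    have hx' : (x' : Site d) ∈ (slabBox S N).image g := by rw [himg]; exact x'.2
    obtain ⟨z, hz, hzx⟩ := Finset.mem_image.1 hx'
    have : z = x := by
      rw [hxdef, ← hzx, hg, zdSignedPermIso_apply, Equiv.symm_apply_apply]
    rw [← this]; exact hz
  have h := hmain N x hx
  have ht := fkLaw_image_iso_restrW_lattW_real_openConnIn g (slabBox S N) S.p hq0 0 x
  rw [himg, hgx, show g 0 = 0 by rw [hg, zdSignedPermIso_apply, Site.signedPerm_zero]] at ht
  have hfin := fkLaw_fkSlab_real_openConnIn S.p hq0 (5 * S.C.r) N x'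
  rw [ht] at hfin
  rw [← hfin]
  exact h

/-- **`UFSC0` at `p` puts the slab threshold below `p`**: `UFSC0 d q p r ε₀` (`q ≥ 1`, `4ε₀ ≤ 2⁻³²`, `0 < p`) gives
`p̂_c(q) ≤ p`. [cite: Grimmett2006, §5.7 eq. (5.102); Severo2024, §1] -/
theorem fkSlabCriticalProb_le_of_ufsc0 {q ε₀ : ℝ} (hq : 1 ≤ q) (hε : 4 * ε₀ ≤ (1 / 2 : ℝ) ^ 32) {p : unitInterval}
    (hp : 0 < (p : ℝ)) {r : ℕ} (hU : UFSC0 d q p r ε₀) : fkSlabCriticalProb d q ≤ (p : ℝ) :=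
  fkSlabCriticalProb_le_of_fkSlabPercolation p.2 (fkSlabPercolation_of_ufsc0 hq hε hp hU)

/-- **K1 AS A KERNEL EQUIVALENCE** (`d ≥ 3`, `q ≥ 1`, `0 < ε₀`, `4ε₀ ≤ 2⁻³²`, `0 < p < 1`): the record's conclusion
`∃ r, UFSC0 d q p r ε₀` holds IFF Grimmett's finite free-slab percolation `Π(p, L)` holds for some `L`
(`fkSlabPercolation_of_ufsc0` and T4s-18's `ufsc0_of_exists_fkSlabPercolation`). Consequently the conditional record
`ufsc0_of_freeBoundaryHypothesis_r3` reads: FH ∧ TP_FK at `p` ⟹ `Π(p, L)` for some `L`, i.e. `p̂_c(q) ≤ p` — the calibration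
K1 ("[C3a ∀ p > p_c(q)] ∧ C3b ⇒ p̂_c(q) = p_c(q) = Conj. (5.103)") with both sides now printed objects. NOT a discharge of
FH or TP_FK. [cite: Grimmett2006, §5.7 eq. (5.102), Conj. (5.103); KozmaNitzan2024, §4 Theorem 6] -/
theorem exists_ufsc0_iff_exists_fkSlabPercolation (hd : 3 ≤ d) {q ε₀ : ℝ} (hq : 1 ≤ q) (hε₀ : 0 < ε₀)
    (hε : 4 * ε₀ ≤ (1 / 2 : ℝ) ^ 32) (p : unitInterval) (hp : (p : ℝ) ∈ Set.Ioo 0 1) :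
    (∃ r : ℕ, UFSC0 d q p r ε₀) ↔ ∃ L : ℕ, FKSlabPercolation d (p : ℝ) q L :=
  ⟨fun ⟨r, hU⟩ => ⟨5 * r, fkSlabPercolation_of_ufsc0 hq hε hp.1 hU⟩,
    ufsc0_of_exists_fkSlabPercolation hd hq hε₀ p hp⟩

end Summit.CriticalPhenomena.PercolationContinuityZ3.Theorems.FK

end
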